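import Mathlib
import Literature.Analysis.FluidPDE.TypeIAncientMild
import Literature.Analysis.FluidPDE.TypeIAncientMildRescale
import Literature.Analysis.FluidPDE.LocalPressureLiouvilleKernel
import Literature.Analysis.UnboundedOperators.HeatKernelBoundedData
import Literature.Analysis.UnboundedOperators.HeatKernelHeatEquation
import Literature.Analysis.UnboundedOperators.HeatKernelGradient
import Literature.Analysis.UnboundedOperators.HeatKernelReversePoincare
import Literature.Analysis.UnboundedOperators.HeatKernelPoincare
import Literature.Analysis.UnboundedOperators.HeatIteratedDerivBounds
import Summits.NavierStokesRegularity.NavierStokesRegularity.Theorems.SymmetryModuliCountFarPastLedger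
import Summits.NavierStokesRegularity.NavierStokesRegularity.Theorems.SymmetryModuliCountSymmetricLiouvilleSmallAtMinusInfinity
import Summits.NavierStokesRegularity.NavierStokesRegularity.Theorems.IsobarTomographyBlobRiccatiClosureTypeIGaugeBounds
import Summits.NavierStokesRegularity.NavierStokesRegularity.Theorems.ClockStretchingLawSmallStrainRung
import HarnessLib

/-!
# Census block A2 (amplitude meters), cells A2kp / A2k1 / A2kb / A2k0 (DECIDED), laws A2kf / A2kl (structural), A2kP / A2kU (OPEN) — instrument «SUBGRID METER», LINE
# «subgrid-meter» port, part 1/3: the instrument `cVar` / `sgVar` (§A), `ℝ³` bookkeeping (§B), components under the heat extension (§C), resolved strain from the window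
# variance (§D), subgrid strain (§E)

Re-homed for the scenario census (typer seat ns-census-typer-1 g8; cells of ns-idea-2 g15 LINE «subgrid-meter» dceda87d33ef0baf, critic idea-crit-3 g8 verdict 05:34Z,
members OF RECORD since census v1.84; this port makes the decided cells TREE-decided): VERBATIM PORT of `pub/ideators/ns-idea-2/lines/subgrid-meter/line-subgrid-meter.lean`
sha16 dceda87d33ef0baf (743 l., lean check rc 0, 0 sorry), split for the 400-line rule into `ScenarioCensusSubgridMeter` (§A–§E) → `…SubgridMeterLaws` (§F–§H) →
`…SubgridMeterRows` (§K, §I–§J + census KEYS).  Lean text VERBATIM in namespace `…Theorems.ScenarioCensus.SubgridMeter` (the line's `…Lines.SubgridMeter` re-homed);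
port edits: `local notation "E3"` → `abbrev E3` (typer lint: no notation in port files), `@[conjecture]` on the OPEN rows `Row_A2kP` / `Row_A2kU` (typed only), one-line
docstrings added where missing (gate lint); the coordinate bound `norm_apply_le_norm` (`‖v i‖ ≤ ‖v‖`, twin of landed tree lemmas) is not re-declared — its uses are
Mathlib's `PiLp.norm_apply_le` (proof text only).  Statements untouched.

No census VALUE is moved here (the cells become TREE-decided by name; booking is the lead's); NS regularity is NOT proved; (L′) ⟨10661⟩ is untouched; no summit
statement is proved by this file. Lemmas that restate already-landed tree declarations are taken BY NAME (gate lint `dedup.landed`): `norm_apply_le_norm` = `PiLp.norm_apply_le`.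
-/

-- the summit and its single problem share the name `NavierStokesRegularity` (D-0017 nested layout)
set_option linter.dupNamespace false

noncomputable section

open Set Function Filter Topology Metric MeasureTheory
open scoped RealInnerProductSpace ENNReal NNReal

namespace Summit.NavierStokesRegularity.NavierStokesRegularity.Theorems.ScenarioCensus.SubgridMeter

open Literature.Analysis Literature.Analysis.FluidPDE Literature.Analysis.UnboundedOperators
open Summit.NavierStokesRegularity.NavierStokesRegularity.Theorems
open Summit.NavierStokesRegularity.NavierStokesRegularity.Theorems.BlobRiccatiClosure.TypeIApexLiouville
  (stub_typeIGaugeBounds)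
open Summit.NavierStokesRegularity.NavierStokesRegularity.Theorems.SymmetryModuliCountSymmetricLiouville
  (vanishes_of_vanishes_before)

/-- `ℝ³` (the line's `local notation "E3"`, spelled as a reducible abbreviation for the tree). -/
abbrev E3 := EuclideanSpace ℝ (Fin 3)

/-! ## A. The instrument -/

/-- Window variance of a scalar observable at heat time `s`:
`Var_s[f](x) = e^{sΔ}(f²)(x) − (e^{sΔ}f(x))²`. -/
def cVar (f : E3 → ℝ) (s : ℝ) (x : E3) : ℝ :=
  heatExtension (fun y => f y ^ 2) s x - heatExtension f s x ^ 2

/-- **Subgrid kinetic energy** (×2) of a velocity slice in the Gaussian window of heat time `s`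
at `x`: `Σᵢ Var_s[vᵢ](x) = e^{sΔ}|v|²(x) − |e^{sΔ}v(x)|²`, the trace of the subgrid stress. -/
def sgVar (v : E3 → E3) (s : ℝ) (x : E3) : ℝ := ∑ i : Fin 3, cVar (fun y => v y i) s x

/-- The coordinate functional `v ↦ vᵢ` as a continuous linear map. -/
def prj (i : Fin 3) : E3 →L[ℝ] ℝ := PiLp.proj 2 (fun _ : Fin 3 => ℝ) i

/-- Unfolding `prj`. -/
@[simp] theorem prj_apply (i : Fin 3) (v : E3) : prj i v = v i := rfl

/-! ## B. Elementary `ℝ³` bookkeeping -/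

-- `norm_apply_le_norm`: the line restates the tree's `PiLp.norm_apply_le`; taken BY NAME (gate lint dedup.landed).

/-- `‖v‖ ≤ ∑ᵢ ‖vᵢ‖`. -/
theorem norm_le_sum_norm_apply (v : E3) : ‖v‖ ≤ ∑ i, ‖v i‖ := by
  rw [EuclideanSpace.norm_eq v]
  have hnn : 0 ≤ ∑ i, ‖v i‖ := Finset.sum_nonneg fun i _ => norm_nonneg _
  have h : ∑ i, ‖v i‖ ^ 2 ≤ (∑ i, ‖v i‖) ^ 2 := by
    simp only [Fin.sum_univ_three]
    nlinarith [norm_nonneg (v 0), norm_nonneg (v 1), norm_nonneg (v 2)]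
  calc Real.sqrt (∑ i, ‖v i‖ ^ 2) ≤ Real.sqrt ((∑ i, ‖v i‖) ^ 2) := Real.sqrt_le_sqrt h
    _ = ∑ i, ‖v i‖ := Real.sqrt_sq hnn

/-- `‖prj i‖ ≤ 1`. -/
theorem norm_prj_le (i : Fin 3) : ‖prj i‖ ≤ 1 :=
  ContinuousLinearMap.opNorm_le_bound _ zero_le_one fun v => by
    rw [one_mul, prj_apply]; exact PiLp.norm_apply_le v i

/-- The operator norm of a linear map into `ℝ³` is at most the sum of the norms of its three
component functionals. -/
theorem opNorm_le_sum_proj (A : E3 →L[ℝ] E3) : ‖A‖ ≤ ∑ i, ‖(prj i).comp A‖ := by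
  refine ContinuousLinearMap.opNorm_le_bound _ (Finset.sum_nonneg fun i _ => norm_nonneg _)
    fun v => ?_
  calc ‖A v‖ ≤ ∑ i, ‖A v i‖ := norm_le_sum_norm_apply (A v)
    _ = ∑ i, ‖((prj i).comp A) v‖ := by simp
    _ ≤ ∑ i, ‖(prj i).comp A‖ * ‖v‖ :=
        Finset.sum_le_sum fun i _ => ContinuousLinearMap.le_opNorm _ _
    _ = (∑ i, ‖(prj i).comp A‖) * ‖v‖ := (Finset.sum_mul _ _ _).symm

/-! ## C. Components under the heat extension -/

/-- Components of a continuous field are continuous. -/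
theorem continuous_apply_comp {v : E3 → E3} (hv : Continuous v) (i : Fin 3) :
    Continuous fun z => v z i := by
  simpa [Function.comp_def] using (prj i).continuous.comp hv

/-- `e^{sΔ}(vᵢ) = (e^{sΔ}v)ᵢ` for bounded continuous `v`. -/
theorem heatExtension_apply_comp {v : E3 → E3} (hv : Continuous v) {M : ℝ}
    (hM : ∀ z, ‖v z‖ ≤ M) {s : ℝ} (hs : 0 < s) (i : Fin 3) (x : E3) :
    heatExtension (fun y => v y i) s x = heatExtension v s x i := by
  have := heatExtension_clm_comp_of_bound (prj i) hv hM hs x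
  simpa using this

/-- `∇(e^{sΔ}vᵢ)(x) = prjᵢ ∘ ∇(e^{sΔ}v)(x)`. -/
theorem fderiv_heatExtension_comp {v : E3 → E3} (hv : Continuous v) {M : ℝ}
    (hM : ∀ z, ‖v z‖ ≤ M) {s : ℝ} (hs : 0 < s) (i : Fin 3) (x : E3) :
    fderiv ℝ (heatExtension (fun y => v y i) s) x =
      (prj i).comp (fderiv ℝ (heatExtension v s) x) := by
  have hfun : heatExtension (fun y => v y i) s = fun x => prj i (heatExtension v s x) := by
    funext x; rw [heatExtension_apply_comp hv hM hs i x, prj_apply]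
  have hmem : MemLp v ∞ volume := memLp_top_of_continuous_of_bound hv hM
  have hd : DifferentiableAt ℝ (heatExtension v s) x :=
    (hasFDerivAt_heatExtension hmem le_top hs x).differentiableAt
  rw [hfun]
  exact ((prj i).hasFDerivAt.comp x hd.hasFDerivAt).fderiv

/-! ## D. Step 1 — resolved strain from the window variance (reverse Poincaré) -/

/-- **Reverse Poincaré, variance form**: `2s‖∇e^{sΔ}f(x)‖² ≤ Var_s[f](x)` (the tree's
`sq_heatExtension_add_le_heatExtension_sq`, Bakry–Ledoux; sharp). -/
theorem two_mul_sq_norm_fderiv_le_cVar {f : E3 → ℝ} (hf : Continuous f) {M : ℝ}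
    (hM : ∀ z, ‖f z‖ ≤ M) {s : ℝ} (hs : 0 < s) (x : E3) :
    2 * s * ‖fderiv ℝ (heatExtension f s) x‖ ^ 2 ≤ cVar f s x := by
  have h := sq_heatExtension_add_le_heatExtension_sq hf hM hs x
  unfold cVar
  linarith

/-- `0 ≤ cVar`. -/
theorem cVar_nonneg {f : E3 → ℝ} (hf : Continuous f) {M : ℝ} (hM : ∀ z, ‖f z‖ ≤ M) {s : ℝ}
    (hs : 0 < s) (x : E3) : 0 ≤ cVar f s x :=
  le_trans (by positivity) (two_mul_sq_norm_fderiv_le_cVar hf hM hs x)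

/-- `0 ≤ sgVar`. -/
theorem sgVar_nonneg {v : E3 → E3} (hv : Continuous v) {M : ℝ} (hM : ∀ z, ‖v z‖ ≤ M) {s : ℝ}
    (hs : 0 < s) (x : E3) : 0 ≤ sgVar v s x :=
  Finset.sum_nonneg fun i _ => cVar_nonneg (continuous_apply_comp hv i)
    (fun z => (PiLp.norm_apply_le (v z) i).trans (hM z)) hs x

/-! ## E. Step 2 — subgrid strain (derivatives fall on the data, mean value, first moment) -/

/-- `2^{3/2} ≤ 3`. -/
theorem two_rpow_three_halves_le : (2 : ℝ) ^ ((3 : ℝ) / 2) ≤ 3 := by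
  have h : (2 : ℝ) ^ ((3 : ℝ) / 2) = Real.sqrt 8 := by
    rw [show ((3 : ℝ) / 2) = (3 : ℝ) * (1 / 2) by norm_num, Real.rpow_mul (by norm_num),
      show (2 : ℝ) ^ (3 : ℝ) = 8 by norm_num, Real.sqrt_eq_rpow]
  rw [h]
  have h89 : Real.sqrt 8 ≤ Real.sqrt 9 := Real.sqrt_le_sqrt (by norm_num)
  have h9 : Real.sqrt 9 = 3 := by
    rw [show (9 : ℝ) = 3 ^ 2 by norm_num, Real.sqrt_sq (by norm_num)]
  linarith

/-- First Gaussian moment in `ℝ³`: `∫ G_s(z)|z| dz ≤ 6√s`. -/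
theorem integral_heatKernel_mul_norm_le_six {s : ℝ} (hs : 0 < s) :
    ∫ z : E3, heatKernel s z * ‖z‖ ≤ 6 * Real.sqrt s := by
  have h := integral_heatKernel_mul_norm_le (E := E3) hs
  rw [finrank_euclideanSpace_fin] at h
  have h3 : (2 : ℝ) ^ (((3 : ℕ) : ℝ) / 2) ≤ 3 := by exact_mod_cast two_rpow_three_halves_le
  have hsq : s ^ (1 / 2 : ℝ) = Real.sqrt s := (Real.sqrt_eq_rpow s).symm
  rw [hsq] at h
  have hs0 : 0 ≤ Real.sqrt s := Real.sqrt_nonneg _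
  calc ∫ z : E3, heatKernel s z * ‖z‖ ≤ 2 * (2 : ℝ) ^ (((3 : ℕ) : ℝ) / 2) * Real.sqrt s := h
    _ ≤ 2 * 3 * Real.sqrt s := by gcongr
    _ = 6 * Real.sqrt s := by ring

/-- **Subgrid strain.** For `v ∈ C²` bounded with two bounded derivatives, `‖D²v‖ ≤ C₂`:
`‖∇v(x) − ∇(e^{sΔ}v)(x)‖ ≤ 6 C₂ √s`. -/
theorem norm_fderiv_sub_fderiv_heatExtension_le {v : E3 → E3} (hv : ContDiff ℝ 2 v)
    {C₀ C₁ C₂ : ℝ} (h0 : ∀ z, ‖v z‖ ≤ C₀) (h1 : ∀ z, ‖fderiv ℝ v z‖ ≤ C₁)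
    (h2 : ∀ z, ‖fderiv ℝ (fderiv ℝ v) z‖ ≤ C₂) {s : ℝ} (hs : 0 < s) (x : E3) :
    ‖fderiv ℝ v x - fderiv ℝ (heatExtension v s) x‖ ≤ C₂ * (6 * Real.sqrt s) := by
  have hv1 : ContDiff ℝ 1 v := hv.of_le (by norm_cast)
  have hg1 : ContDiff ℝ 1 (fderiv ℝ v) := hv.fderiv_right (by norm_cast)
  have hgc : Continuous (fderiv ℝ v) := hg1.continuous
  have hgd : Differentiable ℝ (fderiv ℝ v) := hg1.differentiable one_ne_zero
  have hC₂ : 0 ≤ C₂ := le_trans (norm_nonneg (fderiv ℝ (fderiv ℝ v) 0)) (h2 0)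
  rw [fderiv_heatExtension_of_bounded hv1 h0 h1 hs x, heatExtension_apply]
  have hconst : fderiv ℝ v x = ∫ z : E3, heatKernel s z • fderiv ℝ v x := by
    rw [integral_smul_const, integral_heatKernel_eq_one_holds hs, one_smul]
  rw [hconst, ← integral_sub ((integrable_heatKernel_holds hs).smul_const _)
    (integrable_heatKernel_smul_of_bound hgc h1 hs x)]
  calc ‖∫ z : E3, (heatKernel s z • fderiv ℝ v x - heatKernel s z • fderiv ℝ v (x - z))‖
      ≤ ∫ z : E3, ‖heatKernel s z • fderiv ℝ v x - heatKernel s z • fderiv ℝ v (x - z)‖ :=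
        norm_integral_le_integral_norm _
    _ ≤ ∫ z : E3, heatKernel s z * ‖z‖ * C₂ := by
        refine integral_mono_of_nonneg (Eventually.of_forall fun z => norm_nonneg _)
          ((integrable_heatKernel_mul_norm hs).mul_const C₂) (Eventually.of_forall fun z => ?_)
        have hmv : ‖fderiv ℝ v x - fderiv ℝ v (x - z)‖ ≤ C₂ * ‖x - (x - z)‖ :=
          convex_univ.norm_image_sub_le_of_norm_fderiv_le (fun y _ => hgd y) (fun y _ => h2 y)
            (mem_univ (x - z)) (mem_univ x)
        rw [sub_sub_cancel] at hmv
        show ‖heatKernel s z • fderiv ℝ v x - heatKernel s z • fderiv ℝ v (x - z)‖ ≤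
          heatKernel s z * ‖z‖ * C₂
        rw [show heatKernel s z • fderiv ℝ v x - heatKernel s z • fderiv ℝ v (x - z) =
            heatKernel s z • (fderiv ℝ v x - fderiv ℝ v (x - z)) from (smul_sub _ _ _).symm,
          norm_smul, Real.norm_of_nonneg (heatKernel_pos hs z).le]
        calc heatKernel s z * ‖fderiv ℝ v x - fderiv ℝ v (x - z)‖
            ≤ heatKernel s z * (C₂ * ‖z‖) := mul_le_mul_of_nonneg_left hmv (heatKernel_pos hs z).le
          _ = heatKernel s z * ‖z‖ * C₂ := by ring
    _ = (∫ z : E3, heatKernel s z * ‖z‖) * C₂ := integral_mul_const _ _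
    _ ≤ 6 * Real.sqrt s * C₂ :=
        mul_le_mul_of_nonneg_right (integral_heatKernel_mul_norm_le_six hs) hC₂
    _ = C₂ * (6 * Real.sqrt s) := by ring

end Summit.NavierStokesRegularity.NavierStokesRegularity.Theorems.ScenarioCensus.SubgridMeter

end
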